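import Mathlib
import HarnessLib

/-!
# Directed unions of local rings along blow-up towers are local and `t`-prevaluative
# (crux `WildQuotients.WildQuotientResolution`, stub `stub_phaseZeroHighDim`: step (P6') of the port of (H1),
# the hypothesis `hpv` of ✓`PrevaluativeRing`)

Crux stmt-ResolutionOfSingularities-15640 (`WildQuotientResolution`), registered stub `stub_phaseZeroHighDim`,
residual (H1) = Abbes–Saito 2011 Prop. 2.22. The chain ring `O_ξ = ⋃_ψ O_{X_ψ, x_ψ}` of a point of the
Zariski–Riemann space of a pair (Lemma 2.19 (i)) is a DIRECTED UNION of local rings inside the function field,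
and "every finitely generated `t`-open ideal of `O_ξ` is principal" because such an ideal comes from a finite
stage and becomes principal at the centre of `ξ` on one further `U`-admissible blow-up. This file isolates the
ring theory of that step (no schemes):

* `isLocalRing_iSup_of_directed` — a directed union of local subrings of a field is local;
* `isPrincipal_of_forall_pair` — in any commutative ring, if every ideal `(x, y)` containing a power of `t` is
  principal, then every finitely generated ideal containing a power of `t` is principal (induction on the
  number of generators: `(x₁, tⁿ) = (d₁)`, `(d₁, x₂) = (d₂)`, …) — so the hypothesis `hpv` of
  ✓`PrevaluativeRing` may be checked on pairs;
* `isPrincipal_pair_iSup` — in a directed union `O = ⋃ᵢ Oᵢ` of subrings, if every pair ideal of an `Oᵢ`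
  containing a power of `t` becomes principal in some larger `Oⱼ` (one more blow-up), then every pair ideal
  of `O` containing a power of `t` is principal; with the previous item, `O` is `t`-prevaluative
  (`isPrincipal_of_fg_iSup`).

[OURS · crux stmt-ResolutionOfSingularities-15640 · helper toward `stub_phaseZeroHighDim` (step P6' of the port of
the named fact (H1), evidence memo PHASE0-H1-PORTPLAN.md; NOT a proof of the stub); counted 0; AI-level work,
weaker than expert review.] [cite: AbbesSaito2011, Lemma 2.19 (i)] [folklore]
-/

-- single-problem summit: the doubled namespace component `ResolutionOfSingularities` is forced
set_option linter.dupNamespace false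

noncomputable section

namespace Summit.ResolutionOfSingularities.ResolutionOfSingularities.Theorems.WildQuotientResolution.DirectedUnionPrevaluative

universe u v

/-! ## Pairs suffice -/

section Pairs

variable {R : Type u} [CommRing R] (t : R)

/-- If `(d) ∋ tⁿ` and every `t`-open pair ideal is principal, then `(d, s)` is principal for every finite `s`
(induction on `s`: `(d, a) = (d')` with `tⁿ ∈ (d')`). [folklore] -/
theorem isPrincipal_insert_of_forall_pair
    (hpair : ∀ x y : R, (∃ n : ℕ, t ^ n ∈ Ideal.span {x, y}) → (Ideal.span {x, y}).IsPrincipal)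
    (s : Finset R) : ∀ d : R, (∃ n : ℕ, t ^ n ∈ Ideal.span {d}) →
      (Ideal.span (insert d (s : Set R))).IsPrincipal := by
  classical
  induction s using Finset.induction_on with
  | empty => intro d _; rw [Finset.coe_empty, ← Set.singleton_def]; exact ⟨d, rfl⟩
  | insert a s ha ih =>
    intro d hd
    obtain ⟨n, hn⟩ := hd
    -- `(d, a)` is `t`-open, hence principal `= (d')`
    have hda : t ^ n ∈ Ideal.span {d, a} :=
      Ideal.span_mono (Set.singleton_subset_iff.mpr (Set.mem_insert _ _)) hn
    obtain ⟨d', hd'⟩ := hpair d a ⟨n, hda⟩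
    have hd'span : Ideal.span {d, a} = Ideal.span {d'} := by rw [hd']
    -- `(d, a, s) = (d', s)`
    have heq : Ideal.span (insert d (↑(insert a s) : Set R)) = Ideal.span (insert d' (s : Set R)) := by
      rw [Finset.coe_insert]
      have h1 : Ideal.span {d, a} ≤ Ideal.span (insert d' (s : Set R)) := by
        rw [hd'span]
        exact Ideal.span_mono (Set.singleton_subset_iff.mpr (Set.mem_insert _ _))
      have h2 : Ideal.span {d'} ≤ Ideal.span (insert d (insert a (s : Set R))) := by
        rw [← hd'span]
        exact Ideal.span_mono (Set.insert_subset_insert (Set.singleton_subset_iff.mpr (Set.mem_insert _ _)))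
      apply le_antisymm
      · rw [Ideal.span_le]
        intro x hx
        rcases hx with hx | hx | hx
        · exact h1 (Ideal.subset_span (by rw [hx]; exact Set.mem_insert _ _))
        · exact h1 (Ideal.subset_span (by rw [hx]; exact Set.mem_insert_of_mem _ (Set.mem_singleton _)))
        · exact Ideal.subset_span (Set.mem_insert_of_mem _ hx)
      · rw [Ideal.span_le]
        intro x hx
        rcases hx with hx | hx
        · exact h2 (Ideal.subset_span (by rw [hx]; exact Set.mem_singleton _))
        · exact Ideal.subset_span (Set.mem_insert_of_mem _ (Set.mem_insert_of_mem _ hx))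
    rw [heq]
    exact ih d' ⟨n, hd'span ▸ hda⟩

/-- **Pairs suffice for prevaluativity**: if every ideal `(x, y)` containing a power of `t` is principal, then
every finitely generated ideal containing a power of `t` is principal. [folklore] -/
theorem isPrincipal_of_forall_pair
    (hpair : ∀ x y : R, (∃ n : ℕ, t ^ n ∈ Ideal.span {x, y}) → (Ideal.span {x, y}).IsPrincipal)
    (J : Ideal R) (hJ : J.FG) (ht : ∃ n : ℕ, t ^ n ∈ J) : J.IsPrincipal := by
  classical
  obtain ⟨s, hs⟩ := hJ
  obtain ⟨n, hn⟩ := ht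
  have hJ' : J = Ideal.span (insert (t ^ n) (s : Set R)) := by
    apply le_antisymm
    · rw [← hs]; exact Ideal.span_mono (Set.subset_insert _ _)
    · rw [Ideal.span_le, Set.insert_subset_iff]
      exact ⟨hn, hs ▸ Ideal.subset_span⟩
  rw [hJ']
  exact isPrincipal_insert_of_forall_pair t hpair s (t ^ n) ⟨n, Ideal.mem_span_singleton_self _⟩

end Pairs

/-! ## Directed unions -/

section Union

variable {K : Type u} [Field K] {ι : Type v} [Preorder ι] [IsDirectedOrder ι] [Nonempty ι]
  (O : ι → Subring K) (hmono : Monotone O)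

include hmono in
/-- **A directed union of local subrings of a field is local** (a unit of some `Oᵢ` is a unit of the union).
[folklore] -/
theorem isLocalRing_iSup_of_directed (hloc : ∀ i, IsLocalRing (O i)) :
    IsLocalRing (⨆ i, O i : Subring K) := by
  refine IsLocalRing.of_isUnit_or_isUnit_one_sub_self fun y => ?_
  obtain ⟨i, hi⟩ := (Subring.mem_iSup_of_directed hmono.directed_le).mp y.2
  have hle : O i ≤ ⨆ i, O i := le_iSup O i
  rcases IsLocalRing.isUnit_or_isUnit_one_sub_self (⟨(y : K), hi⟩ : O i) with h | h
  · left
    have := h.map (Subring.inclusion hle)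
    exact this
  · right
    have := h.map (Subring.inclusion hle)
    rwa [map_sub, map_one] at this

include hmono in
/-- **`t`-open pair ideals of a directed union are principal** as soon as every `t`-open pair ideal of each
`Oᵢ` becomes principal in some larger `Oⱼ` ("after one more admissible blow-up").
[cite: AbbesSaito2011, Lemma 2.19 (i)] -/
theorem isPrincipal_pair_iSup (t : K)
    (hblow : ∀ (i : ι) (x y : O i), (∃ n : ℕ, ∃ c d : O i, (c * x + d * y : K) = t ^ n) →
      ∃ (j : ι) (hij : i ≤ j) (e : O j), Ideal.span {Subring.inclusion (hmono hij) x,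
        Subring.inclusion (hmono hij) y} = Ideal.span {e})
    (x y : (⨆ i, O i : Subring K)) (hxy : ∃ n : ℕ, ∃ h : t ^ n ∈ (⨆ i, O i : Subring K),
      (⟨t ^ n, h⟩ : (⨆ i, O i : Subring K)) ∈ Ideal.span {x, y}) :
    (Ideal.span {x, y}).IsPrincipal := by
  classical
  obtain ⟨n, htn, hmem⟩ := hxy
  obtain ⟨c, d, hcd⟩ := Ideal.mem_span_pair.mp hmem
  have hdir := hmono.directed_le
  -- a common stage for `x, y, c, d`
  obtain ⟨ix, hix⟩ := (Subring.mem_iSup_of_directed hdir).mp x.2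
  obtain ⟨iy, hiy⟩ := (Subring.mem_iSup_of_directed hdir).mp y.2
  obtain ⟨ic, hic⟩ := (Subring.mem_iSup_of_directed hdir).mp c.2
  obtain ⟨id, hid⟩ := (Subring.mem_iSup_of_directed hdir).mp d.2
  obtain ⟨i, hi⟩ := Finset.exists_le ({ix, iy, ic, id} : Finset ι)
  have hx : (x : K) ∈ O i := hmono (hi ix (by simp)) hix
  have hy : (y : K) ∈ O i := hmono (hi iy (by simp)) hiy
  have hc : (c : K) ∈ O i := hmono (hi ic (by simp)) hic
  have hd : (d : K) ∈ O i := hmono (hi id (by simp)) hid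
  -- one more blow-up
  obtain ⟨j, hij, e, he⟩ := hblow i ⟨x, hx⟩ ⟨y, hy⟩ ⟨n, ⟨c, hc⟩, ⟨d, hd⟩, by
    have := congrArg Subtype.val hcd
    simpa using this⟩
  -- push down to the union along `O j ≤ ⨆ O`
  let φ : O j →+* (⨆ i, O i : Subring K) := Subring.inclusion (le_iSup O j)
  have hxe : φ (Subring.inclusion (hmono hij) ⟨x, hx⟩) = x := Subtype.ext rfl
  have hye : φ (Subring.inclusion (hmono hij) ⟨y, hy⟩) = y := Subtype.ext rfl
  refine ⟨φ e, ?_⟩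
  have := congrArg (Ideal.map φ) he
  rw [Ideal.map_span, Ideal.map_span, Set.image_pair, Set.image_singleton, hxe, hye] at this
  rw [this]

include hmono in
/-- **A directed union of subrings along a blow-up tower is `t`-prevaluative**: every finitely generated
ideal of `⋃ Oᵢ` containing a power of `t` is principal (pairs by `isPrincipal_pair_iSup`, then
`isPrincipal_of_forall_pair`). This is the hypothesis `hpv` of ✓`PrevaluativeRing`.
[cite: AbbesSaito2011, Lemma 2.19 (i)] -/
theorem isPrincipal_of_fg_iSup (t : K) (ht : t ∈ (⨆ i, O i : Subring K))
    (hblow : ∀ (i : ι) (x y : O i), (∃ n : ℕ, ∃ c d : O i, (c * x + d * y : K) = t ^ n) →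
      ∃ (j : ι) (hij : i ≤ j) (e : O j), Ideal.span {Subring.inclusion (hmono hij) x,
        Subring.inclusion (hmono hij) y} = Ideal.span {e})
    (J : Ideal (⨆ i, O i : Subring K)) (hJ : J.FG)
    (hJt : ∃ n : ℕ, (⟨t, ht⟩ : (⨆ i, O i : Subring K)) ^ n ∈ J) : J.IsPrincipal := by
  refine isPrincipal_of_forall_pair (⟨t, ht⟩ : (⨆ i, O i : Subring K)) (fun x y hxy => ?_) J hJ hJt
  obtain ⟨n, hn⟩ := hxy
  have hcoe : (((⟨t, ht⟩ : (⨆ i, O i : Subring K)) ^ n : (⨆ i, O i : Subring K)) : K) = t ^ n :=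
    SubmonoidClass.coe_pow _ n
  refine isPrincipal_pair_iSup O hmono t hblow x y ⟨n, hcoe ▸ ((⟨t, ht⟩ : (⨆ i, O i : Subring K)) ^ n).2, ?_⟩
  convert hn using 1
  exact Subtype.ext hcoe.symm

end Union

end Summit.ResolutionOfSingularities.ResolutionOfSingularities.Theorems.WildQuotientResolution.DirectedUnionPrevaluative

end
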